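import Literature.Geometry.Riemannian.BamlerDistanceDistortion
import Literature.Geometry.Riemannian.DistSqEnergyBarrier
import Literature.Geometry.Riemannian.RicciFlowScalarCurvatureHolds
import HarnessLib

/-!
# Bamler's distance-distortion estimate `(∂ₜ − Δ_x − Δ_y) d_t² ≥ −H_n` in the barrier sense:
# proof (Bamler 2020a, Thm. 3.5) and discharge of `bamler_distSq_heatOperator_barrier`

R. Bamler, *Entropy and heat kernel bounds on a Ricci flow background*, arXiv:2008.07093 (2020a),
§3.1 Thm. 3.5 and §3.2 (proof). The named fact `bamler_distSq_heatOperator_barrier`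
(`BamlerDistanceDistortion.lean`) states the barrier form for Ricci flows on closed manifolds
charted on an arbitrary model `I : ModelWithCorners ℝ (EuclideanSpace ℝ (Fin m)) H` without
boundary. This file PROVES it (`bamler_distSq_heatOperator_barrier_holds`), for manifolds with an
arbitrary boundaryless model with corners on a finite-dimensional space `E` (the parallel
orthonormal frames along curves which the second-variation argument of the printed proof needs are
provided in that generality by `ParallelTransportCorners.lean`):

* `IsRicciFlow.exists_distSq_heatOperator_barrier` — for a `C^∞` family `h` of Riemannian metrics
  on a closed connected manifold with model space `E` (`dim E ≥ 1`) which is a Ricci flow on an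
  interval `S`, at every `(x, y, r)` with `r ∈ S` not the initial time and every `η > 0` there is
  an upper barrier `b ≥ d²` near `(x, y, r)`, touching at the point, with `C²` slices and
  `∂ₜb − Δ_x b − Δ_y b ≥ −H − η`, `H = (dim E − 1)π²/2 + 4`;
* `bamler_distSq_heatOperator_barrier_euclidean` — the same in the exact shape of the named fact
  for `E = EuclideanSpace ℝ (Fin m)`, `H = MetricFlow.concentrationConst m`, and the self model;
* `bamler_distSq_heatOperator_barrier_holds` — the discharge of the named fact.

Proof (Bamler 2020a, §3.2, with the barrier read slice by slice — the fact only asks for `C²`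
slices in `x` and in `y` and a time derivative at the point, so off the three coordinate slices
through `(x, y, r)` the barrier is `d²` itself). For `x ≠ y` let `γ` be a unit speed minimizing
`g_r`-geodesic from `x` to `y` (Hopf–Rinow), `d = d_r(x, y)`.
* time slice: `β₃(t) = d ∫₀ᵈ g_t(γ̇, γ̇) ≥ L_t(γ)² ≥ d_t(x, y)²`, `β₃(r) = d²`,
  `β₃'(r) = −2d ∫₀ᵈ Ric_{g_r}(γ̇, γ̇)` (the flow equation; differentiation under the integral);
* `y`-slice: the endpoint barrier of `DistSqEnergyBarrier.lean` along `γ`,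
  `Δ_y β₂ ≤ 2 + 2d∫₀ᵈ ((n−1)(π/2d)² cos² − sin² Ric(γ̇, γ̇))`;
* `x`-slice: the same along the reversed geodesic, `Δ_x β₁ ≤ 2 + 2d∫₀ᵈ ((n−1)(π/2d)² sin² − cos² Ric(γ̇, γ̇))`;
so that `β₃' − Δ_xβ₁ − Δ_yβ₂ ≥ −4 − (n−1)π²/2 = −H_n` ("Adding both inequalities and combining
the result with (3.7) implies (3.5)"). For `x = y`: `b = d_r(x, ·)² = |exp_x⁻¹ ·|²` on both
slices, `Δ = 2n` each, `0` in time, and `4n ≤ H_n` ("The case `x = y` is clear since the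
right-hand side is smaller than `−4n`").

Everything here is proved; no definitions, no named facts.

## References

* R. H. Bamler, *Entropy and heat kernel bounds on a Ricci flow background*, arXiv:2008.07093
  (2020), §3.1 Thm. 3.5, §3.2 (proof). [Bamler2020Entropy]
* J. M. Lee, *Introduction to Riemannian Manifolds*, 2nd ed. (2018), Cor. 6.12, Thm. 6.19,
  Thm. 10.22. [LeeRiemannianManifolds2018]
-/

noncomputable section

open Bundle Set Function Filter MeasureTheory intervalIntegral
open scoped Manifold ContDiff Topology

namespace Literature.Geometry.Riemannian

open Lorentzian Lorentzian.PseudoRiemannianMetric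

/-! ### §1 Families of metrics evaluated along fields; the time slice -/

section Family

variable {E : Type*} [NormedAddCommGroup E] [NormedSpace ℝ E] {H : Type*} [TopologicalSpace H]
  {I : ModelWithCorners ℝ E H} {M : Type*} [TopologicalSpace M] [ChartedSpace H M]
  [IsManifold I ∞ M]
  {EN : Type*} [NormedAddCommGroup EN] [NormedSpace ℝ EN] {HN : Type*} [TopologicalSpace HN]
  {J : ModelWithCorners ℝ EN HN} {N : Type*} [TopologicalSpace N] [ChartedSpace HN N]
  {h : ℝ → PseudoRiemannianMetric I ∞ E (TangentSpace I : M → Type _)}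

/-- **`g_{τ(y)}(A(y), B(y))` is `C^∞`** for a family of metrics `C^∞` jointly in space and time,
a `C^∞` time function `τ` and `C^∞` fields `A, B` along a map `f : N → M` (Mathlib's
`ContMDiffAt.clm_bundle_apply₂` along the base map, as in `contMDiffAt_val_apply_along`).
[folklore] -/
theorem IsContMDiffFamilyOn.contMDiffAt_val_apply_along (hh : IsContMDiffFamilyOn ∞ h univ)
    {f : N → M} {τ : N → ℝ} {A B : Π y : N, TangentSpace I (f y)} {y : N}
    (hτ : ContMDiffAt J 𝓘(ℝ, ℝ) ∞ τ y)
    (hA : ContMDiffAt J I.tangent ∞ (fun y ↦ (TotalSpace.mk' E (f y) (A y) : TangentBundle I M)) y)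
    (hB : ContMDiffAt J I.tangent ∞ (fun y ↦ (TotalSpace.mk' E (f y) (B y) : TangentBundle I M)) y) :
    ContMDiffAt J 𝓘(ℝ, ℝ) ∞ (fun y ↦ (h (τ y)).val (f y) (A y) (B y)) y := by
  have hf : ContMDiffAt J I ∞ f y := (contMDiffAt_totalSpace.1 hA).1
  have hpair : ContMDiffAt J (I.prod 𝓘(ℝ, ℝ)) ∞ (fun y ↦ (f y, τ y)) y := hf.prodMk hτ
  have hg : ContMDiffAt J (I.prod 𝓘(ℝ, E →L[ℝ] E →L[ℝ] ℝ)) ∞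
      (fun y ↦ TotalSpace.mk' (E →L[ℝ] E →L[ℝ] ℝ)
        (E := fun x : M ↦ TangentSpace I x →L[ℝ] TangentSpace I x →L[ℝ] ℝ) (f y)
          ((h (τ y)).val (f y))) y :=
    (hh.contMDiffAt (univ_prod_univ ▸ univ_mem)).comp y hpair
  have : ContMDiffAt J (I.prod 𝓘(ℝ, ℝ)) ∞
      (fun y ↦ TotalSpace.mk' ℝ (E := Bundle.Trivial M ℝ) (f y) ((h (τ y)).val (f y) (A y) (B y)))
        y := by
    apply ContMDiffAt.clm_bundle_apply₂ (F₁ := E) (F₂ := E)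
    · exact hg
    · exact hA
    · exact hB
  simp only [contMDiffAt_totalSpace] at this
  exact this.2

end Family

section TimeSlice

variable {E : Type*} [NormedAddCommGroup E] [NormedSpace ℝ E] [FiniteDimensional ℝ E]
  {H : Type*} [TopologicalSpace H] {I : ModelWithCorners ℝ E H} {M : Type*} [TopologicalSpace M]
  [ChartedSpace H M] [IsManifold I ∞ M]

/-- **Distance versus energy of a connecting curve**: for a smooth Riemannian metric `g` and a
`C^∞` curve `c` with `c 0 = x`, `c d = y`, `d ≥ 0`: `d(x, y)² ≤ d ∫₀ᵈ g(ċ, ċ)` and the distance is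
finite (`edist_le_length`, arc length as an integral, Cauchy–Schwarz; Lee 2018, Problem 6-23:
`L² ≤ 2(b − a)E`). [cite: LeeRiemannianManifolds2018, Problem 6-23] -/
theorem sq_edist_le_mul_energy_of_contMDiff
    (g : PseudoRiemannianMetric I ∞ E (TangentSpace I : M → Type _)) (hg : g.IsRiemannian)
    {c : ℝ → M} (hc : ContMDiff 𝓘(ℝ, ℝ) I ∞ c) {d : ℝ} (hd : 0 ≤ d) :
    g.edist hg (c 0) (c d) ≠ ⊤ ∧
    (g.edist hg (c 0) (c d)).toReal ^ 2 ≤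
      d * ∫ t in (0 : ℝ)..d, g.val (c t) (velocity I c t) (velocity I c t) := by
  have hnn : ∀ (y : M) (v' : TangentSpace I y), 0 ≤ g.val y v' v' := fun y v' ↦ by
    by_cases hv : v' = 0
    · subst hv
      simp
    · exact (hg y v' hv).le
  have hTl := contMDiff_lift_velocity_of_contMDiff (I := I) hc
  have hsm : ContMDiff 𝓘(ℝ, ℝ) 𝓘(ℝ, ℝ) ∞ (fun t ↦ g.val (c t) (velocity I c t) (velocity I c t)) :=
    fun t ↦ contMDiffAt_val_apply_along g le_rfl (hTl t) (hTl t)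
  have hfc : Continuous fun t ↦ g.val (c t) (velocity I c t) (velocity I c t) := hsm.continuous
  have h1le : (1 : ℕ∞ω) ≤ (∞ : ℕ∞ω) := by exact_mod_cast le_top
  have hc₁ : ContMDiffOn 𝓘(ℝ, ℝ) I 1 c (Icc 0 d) := (hc.of_le h1le).contMDiffOn
  have hdle : g.edist hg (c 0) (c d) ≤ g.length hg c 0 d := g.edist_le_length hg hd hc₁
  have hL := length_eq_ofReal_integral g hg hd hfc
  have hℓ : 0 ≤ ∫ t in (0 : ℝ)..d, Real.sqrt (g.val (c t) (velocity I c t) (velocity I c t)) :=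
    intervalIntegral.integral_nonneg hd fun t _ ↦ Real.sqrt_nonneg _
  rw [hL] at hdle
  refine ⟨ne_top_of_le_ne_top ENNReal.ofReal_ne_top hdle, ?_⟩
  have hdr : (g.edist hg (c 0) (c d)).toReal ≤
      ∫ t in (0 : ℝ)..d, Real.sqrt (g.val (c t) (velocity I c t) (velocity I c t)) :=
    ENNReal.toReal_le_of_le_ofReal hℓ hdle
  have hsc : Continuous fun t ↦ Real.sqrt (g.val (c t) (velocity I c t) (velocity I c t)) :=
    Real.continuous_sqrt.comp hfc
  have hCS := sq_intervalIntegral_le_length_mul_of_continuous hsc hd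
  have hsq : (fun t ↦ Real.sqrt (g.val (c t) (velocity I c t) (velocity I c t)) ^ 2) =
      fun t ↦ g.val (c t) (velocity I c t) (velocity I c t) :=
    funext fun t ↦ Real.sq_sqrt (hnn _ _)
  rw [hsq, sub_zero] at hCS
  exact (pow_le_pow_left₀ ENNReal.toReal_nonneg hdr 2).trans hCS

variable [CompleteSpace E]
  {h : ℝ → PseudoRiemannianMetric I ∞ E (TangentSpace I : M → Type _)}
  {cov : ℝ → CovariantDerivative I E (TangentSpace I : M → Type _)} {S : Set ℝ}

/-- **The Ricci flow equation as a two-sided time derivative.** For a family `C^∞` on all of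
`M × ℝ` which is a Ricci flow on an order-connected time set `S`, at a time `r ∈ S` preceded by
some `s ∈ S`, `(d/dt)|_{t = r} g_t(x)(X, Y) = −2 Ric_{g_r}(x)(X, Y)` as an honest derivative
(the coefficient is differentiable in `t` on `ℝ`, and its derivative within `S ⊇ [s, r]` is the
one prescribed by the flow, `UniqueDiffWithinAt.eq_deriv`). [cite: Hamilton1982, §4, p. 262] -/
theorem IsRicciFlow.hasDerivAt_val_apply_of_mem (hh : IsContMDiffFamilyOn ∞ h univ)
    (hS : S.OrdConnected) (hflow : IsRicciFlow h cov S) {r : ℝ} (hr : r ∈ S)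
    (hs : ∃ s ∈ S, s < r) (x : M) (X Y : TangentSpace I x) :
    HasDerivAt (fun t ↦ (h t).val x X Y) (-2 * (cov r).ricci x X Y) r := by
  obtain ⟨s, hsS, hsr⟩ := hs
  have hdiff : DifferentiableAt ℝ (fun t ↦ (h t).val x X Y) r :=
    ((hh.contDiffOn_val_apply x X Y).differentiableOn (by simp)).differentiableAt univ_mem
  have h1 : HasDerivWithinAt (fun t ↦ (h t).val x X Y) (deriv (fun t ↦ (h t).val x X Y) r) S r :=
    hdiff.hasDerivAt.hasDerivWithinAt
  have h2 := hflow.hasDerivWithinAt r hr x X Y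
  have hIcc : Icc s r ⊆ S := hS.out hsS hr
  have hU : UniqueDiffWithinAt ℝ S r :=
    (uniqueDiffOn_Icc hsr r (right_mem_Icc.2 hsr.le)).mono hIcc
  have heq := hU.eq_deriv S h1 h2
  rw [← heq]
  exact hdiff.hasDerivAt

/-- **Time derivative of the energy of a fixed curve under the Ricci flow**:
`(d/dt)|_{t=r} ∫₀ᵈ g_t(V(s), V(s)) ds = ∫₀ᵈ −2 Ric_{g_r}(V(s), V(s)) ds` for a `C^∞` field `V`
along a `C^∞` curve `γ` (differentiation under the integral sign,
`hasFDerivAt_parametric_intervalIntegral`, the integrand being `C^∞` in `(s, t)`; this is (3.7) of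
Bamler 2020a for `V = γ̇`: `∂ₜ d_t²(x, y) ≥ −2d ∫₀ᵈ Ric(γ′, γ′)`, here for the energy).
[cite: Bamler2020Entropy, §3.2, (3.7)] -/
theorem IsRicciFlow.hasDerivAt_integral_val_along (hh : IsContMDiffFamilyOn ∞ h univ)
    (hS : S.OrdConnected) (hflow : IsRicciFlow h cov S) {r : ℝ} (hr : r ∈ S)
    (hs : ∃ s ∈ S, s < r) {γ : ℝ → M} {V : Π s : ℝ, TangentSpace I (γ s)}
    (hV : ContMDiff 𝓘(ℝ, ℝ) I.tangent ∞
      (fun s ↦ (TotalSpace.mk' E (γ s) (V s) : TangentBundle I M))) (a b : ℝ) :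
    HasDerivAt (fun t ↦ ∫ s in a..b, (h t).val (γ s) (V s) (V s))
      (∫ s in a..b, -2 * (cov r).ricci (γ s) (V s) (V s)) r := by
  -- the integrand is `C^∞` jointly in `(s, t)`
  set K : ℝ × ℝ → ℝ := fun q ↦ (h q.2).val (γ q.1) (V q.1) (V q.1) with hK_def
  have hKm : ContMDiff 𝓘(ℝ, ℝ × ℝ) 𝓘(ℝ, ℝ) ∞ K := by
    have h1 : ContMDiff (𝓘(ℝ, ℝ).prod 𝓘(ℝ, ℝ)) 𝓘(ℝ, ℝ) ∞ K := fun q ↦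
      hh.contMDiffAt_val_apply_along (f := fun q : ℝ × ℝ ↦ γ q.1) (τ := fun q : ℝ × ℝ ↦ q.2)
        contMDiffAt_snd ((hV q.1).comp q contMDiffAt_fst) ((hV q.1).comp q contMDiffAt_fst)
    rw [modelWithCornersSelf_prod, ← chartedSpaceSelf_prod]
    exact h1
  have hK : ContDiff ℝ ∞ K := contMDiff_iff_contDiff.1 hKm
  have hF := Literature.Analysis.FunctionSpaces.hasFDerivAt_parametric_intervalIntegral
    (P := ℝ) hK (by simp) a b r
  -- the partial derivative in `t` at `(s, r)` is `−2 Ric(V s, V s)`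
  have hpt : ∀ s, (fderiv ℝ K (s, r)).comp (ContinuousLinearMap.inr ℝ ℝ ℝ) 1 =
      -2 * (cov r).ricci (γ s) (V s) (V s) := by
    intro s
    have hl : HasDerivAt (fun t : ℝ ↦ ((s, t) : ℝ × ℝ)) ((0 : ℝ), (1 : ℝ)) r :=
      (hasDerivAt_const r s).prodMk (hasDerivAt_id' r)
    have hc : HasDerivAt (fun t ↦ K (s, t)) (fderiv ℝ K (s, r) ((0 : ℝ), (1 : ℝ))) r :=
      ((hK.differentiable (by simp) (s, r)).hasFDerivAt).comp_hasDerivAt r hl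
    have hfl : HasDerivAt (fun t ↦ K (s, t)) (-2 * (cov r).ricci (γ s) (V s) (V s)) r :=
      hflow.hasDerivAt_val_apply_of_mem hh hS hr hs (γ s) (V s) (V s)
    rw [← hc.unique hfl]
    rfl
  have hcont : Continuous fun s ↦ (fderiv ℝ K (s, r)).comp (ContinuousLinearMap.inr ℝ ℝ ℝ) :=
    ((hK.continuous_fderiv (by simp)).comp (continuous_id.prodMk continuous_const)).clm_comp
      continuous_const
  have hD := hF.hasDerivAt
  rw [ContinuousLinearMap.intervalIntegral_apply (hcont.intervalIntegrable _ _)] at hD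
  simp_rw [hpt] at hD
  exact hD

end TimeSlice

/-! ### §2 The reversed geodesic -/

section Reversal

variable {E : Type*} [NormedAddCommGroup E] [NormedSpace ℝ E] [FiniteDimensional ℝ E]
  [CompleteSpace E] {H : Type*} [TopologicalSpace H] {I : ModelWithCorners ℝ E H}
  {M : Type*} [TopologicalSpace M] [ChartedSpace H M] [IsManifold I ∞ M] [T2Space M]
  [BoundarylessManifold I M]
  {cov : CovariantDerivative I E (TangentSpace I : M → Type _)}
  [CovariantDerivative.ContMDiffCovariantDerivative cov 1]

omit [FiniteDimensional ℝ E] [CompleteSpace E] [T2Space M] [BoundarylessManifold I M]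
  [CovariantDerivative.ContMDiffCovariantDerivative cov 1] in
/-- A quadratic quantity `R_x(v, v)` along `TM` does not see the sign of `v` nor the name of the
base point: transport of `cov.ricci` along equal points and opposite vectors. [folklore] -/
theorem ricci_apply_eq_of_eq_of_neg {x₁ x₂ : M} (hx : x₁ = x₂) (v₁ : TangentSpace I x₁)
    (v₂ : TangentSpace I x₂) (hv : (v₁ : E) = -(v₂ : E)) :
    cov.ricci x₁ v₁ v₁ = cov.ricci x₂ v₂ v₂ := by
  subst hx
  have hv' : v₁ = -v₂ := hv
  rw [hv']
  simp only [map_neg, LinearMap.neg_apply, neg_neg]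

/-- **The reversed geodesic.** For a geodesically complete connection and `γ(t) = exp_x(tu)`,
the geodesic from `γ(d)` with initial velocity `−γ̇(d)` is `t ↦ γ(d − t)`: both are geodesics on
`ℝ` with the same initial data (`IsGeodesicOn.comp_affine`, uniqueness
`IsGeodesicOn.eqOn_of_velocity_eq`), and its velocity is `−γ̇(d − t)`. O'Neill 1983, Ch. 3,
Lemma 3.21 ff. [cite: ONeill1983, Ch. 3, Def. 3.20 and Lemma 3.21 ff] -/
theorem expMap_smul_neg_velocity (hc : IsGeodesicallyComplete cov) (x : M) (u : TangentSpace I x)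
    (d t : ℝ) :
    expMap cov (expMap cov x (d • u)) (t • (-(velocity I (fun s ↦ expMap cov x (s • u)) d))) =
        expMap cov x ((d - t) • u) ∧
      (velocity I (fun t' ↦ expMap cov (expMap cov x (d • u))
          (t' • (-(velocity I (fun s ↦ expMap cov x (s • u)) d)))) t : E) =
        -(velocity I (fun s ↦ expMap cov x (s • u)) (d - t) : E) := by
  set γ : ℝ → M := fun s ↦ expMap cov x (s • u) with hγ_def
  have hgeo : IsGeodesic cov γ := isGeodesic_expMap_smul_of_isGeodesicallyComplete hc x u
  set γ₂ : ℝ → M := fun t' ↦ expMap cov (γ d) (t' • (-(velocity I γ d))) with hγ₂_def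
  have hgeo₂ : IsGeodesic cov γ₂ :=
    isGeodesic_expMap_smul_of_isGeodesicallyComplete hc (γ d) (-(velocity I γ d))
  -- the affine reparametrisation `t ↦ γ (-1 * t + d)`
  set γ₃ : ℝ → M := fun t' ↦ γ (-1 * t' + d) with hγ₃_def
  have hgeo₃ : IsGeodesic cov γ₃ := by
    have h := IsGeodesicOn.comp_affine_holds (cov := cov) hgeo (-1) d
    rwa [preimage_univ] at h
  have h0₂ : γ₂ 0 = γ d := by
    show expMap cov (γ d) ((0 : ℝ) • (-(velocity I γ d))) = γ d
    rw [zero_smul]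
    exact expMap_zero (cov := cov) (γ d)
  have h0₃ : γ₃ 0 = γ d := by
    show γ (-1 * 0 + d) = γ d
    rw [mul_zero, zero_add]
  have hv₂ : velocity I γ₂ 0 = -(velocity I γ d) := velocity_expMap_smul_zero (γ d) _
  have hv₃ : (velocity I γ₃ 0 : E) = -(velocity I γ d : E) := by
    have h := velocity_comp_affine (I := I) γ (-1) d 0
    rw [mul_zero, zero_add, neg_one_smul] at h
    exact h
  have heq : EqOn γ₂ γ₃ univ :=
    IsGeodesicOn.eqOn_of_velocity_eq_holds (cov := cov) isOpen_univ ordConnected_univ hgeo₂ hgeo₃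
      (mem_univ 0) (h0₂.trans h0₃.symm) (hv₂.trans hv₃.symm)
  have hfun : γ₂ = γ₃ := funext fun t' ↦ heq (mem_univ t')
  have hpt : γ₃ t = γ (d - t) := by
    show γ (-1 * t + d) = γ (d - t)
    congr 1
    ring
  refine ⟨?_, ?_⟩
  · show γ₂ t = expMap cov x ((d - t) • u)
    rw [hfun, hpt]
  · show (velocity I γ₂ t : E) = -(velocity I γ (d - t) : E)
    rw [hfun]
    have h := velocity_comp_affine (I := I) γ (-1) d t
    rw [neg_one_smul] at h
    refine h.trans ?_
    rw [show -1 * t + d = d - t by ring]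

end Reversal

/-! ### §3 The diagonal case `x = y`: `d(x, ·)²` near `x` -/

section Diagonal

variable {E : Type*} [NormedAddCommGroup E] [NormedSpace ℝ E] [FiniteDimensional ℝ E]
  [CompleteSpace E] {H : Type*} [TopologicalSpace H] {I : ModelWithCorners ℝ E H} [I.Boundaryless]
  {M : Type*} [TopologicalSpace M] [ChartedSpace H M] [IsManifold I ∞ M] [T2Space M]
  (g : PseudoRiemannianMetric I ∞ E (TangentSpace I : M → Type _)) [g.HasLeviCivita]
  [CovariantDerivative.ContMDiffCovariantDerivative g.leviCivita 1]
  [CovariantDerivative.ContMDiffCovariantDerivative g.leviCivita ∞]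

/-- **The squared distance from `x` is a barrier for itself near `x`, with `Δ ≤ 2 dim`**
("the case `x = y` is clear", Bamler 2020a, §3.2): with normal coordinates `L = exp_x⁻¹` near `x`
(`exists_geodesicBall_edist`: `d(x, exp_x v) = |v|`), `β = g_x(L ·, L ·)` equals `d(x, ·)²` near
`x`, vanishes at `x`, is `C^∞` near `x`, and `Hess β(x)(f, f) ≤ 2` for every `g_x`-unit vector
(`β(exp_x(σ f)) = σ²`), whence `Δ β(x) ≤ 2 dim M`. [cite: Bamler2020Entropy, §3.2, proof of Thm. 3.5] -/
theorem exists_distSq_barrier_diagonal (hg : g.IsRiemannian)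
    (hc : IsGeodesicallyComplete g.leviCivita) (x : M) (hpos : 0 < Module.finrank ℝ E) :
    ∃ β : M → ℝ,
      (∀ᶠ y in 𝓝 x, (g.edist hg x y).toReal ^ 2 ≤ β y) ∧ β x = 0 ∧
      (∀ᶠ y in 𝓝 x, CMDiffAt ∞ β y) ∧
      g.laplaceBeltrami β x ≤ 2 * (Module.finrank ℝ E : ℝ) := by
  classical
  -- normal coordinates at `x`
  obtain ⟨εb, hεb, U, hUo, hxU, L, hLF, hFL, -, hLs, -, hdist, -⟩ :=
    exists_geodesicBall_edist g hg x
  set β : M → ℝ := fun y ↦ g.val x (show TangentSpace I x from L y)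
    (show TangentSpace I x from L y) with hβ_def
  -- an orthonormal frame at `x`
  obtain ⟨v, hv⟩ : ∃ v : E, v ≠ 0 := by
    haveI : Nontrivial E := Module.nontrivial_of_finrank_pos hpos
    exact exists_ne 0
  have hvv : 0 < g.val x (show TangentSpace I x from v) (show TangentSpace I x from v) :=
    hg x _ hv
  set c : ℝ := (Real.sqrt (g.val x (show TangentSpace I x from v)
    (show TangentSpace I x from v)))⁻¹ with hc_def
  set u : TangentSpace I x := c • (show TangentSpace I x from v) with hu_def
  have hu : g.val x u u = 1 := by
    have h1 : g.val x u u = c * c * g.val x (show TangentSpace I x from v)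
        (show TangentSpace I x from v) := by
      simp only [hu_def, map_smul, FunLike.coe_smul, Pi.smul_apply, smul_eq_mul]
      ring
    rw [h1, hc_def, ← mul_inv, Real.mul_self_sqrt hvv.le, inv_mul_cancel₀ hvv.ne']
  obtain ⟨k, f₀, -, hf₀on, hcard⟩ := exists_orthonormal_frame_with_head g hg x hu
  -- `L x = 0`
  have hexp0 : riemannianExpMap g x 0 = x := riemannianExpMap_zero g x
  have hL0 : L x = 0 := by
    have h00 : g.val x (show TangentSpace I x from (0 : E)) (show TangentSpace I x from (0 : E)) <
        εb ^ 2 := by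
      change g.val x (0 : TangentSpace I x) (0 : TangentSpace I x) < εb ^ 2
      simp only [map_zero]
      positivity
    exact (congrArg L hexp0).symm.trans (hLF 0 h00).2.2
  have hsmooth : ∀ᶠ y in 𝓝 x, CMDiffAt ∞ β y := by
    filter_upwards [hUo.mem_nhds hxU] with y hy
    have hLy : CMDiffAt ∞ L y := hLs.contMDiffAt (hUo.mem_nhds hy)
    have hG : ContDiff ℝ ∞ fun w : E ↦ (show E →L[ℝ] E →L[ℝ] ℝ from g.val x) w w :=
      (show E →L[ℝ] E →L[ℝ] ℝ from g.val x).contDiff.clm_apply contDiff_id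
    exact (hG.contMDiff (L y)).comp y hLy
  refine ⟨β, ?_, ?_, hsmooth, ?_⟩
  · -- `β = d(x, ·)²` on `U`
    filter_upwards [hUo.mem_nhds hxU] with y hy
    obtain ⟨hsmall, hexpy⟩ := hFL y hy
    have hd := hdist (L y) hsmall
    dsimp only at hd hexpy
    rw [hexpy] at hd
    have hnn : 0 ≤ g.val x (show TangentSpace I x from L y) (show TangentSpace I x from L y) := by
      by_cases h0 : (show TangentSpace I x from L y) = 0
      · rw [h0]; simp
      · exact (hg x _ h0).le
    rw [hd, ENNReal.toReal_ofReal (Real.sqrt_nonneg _), Real.sq_sqrt hnn]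
  · show g.val x (show TangentSpace I x from L x) (show TangentSpace I x from L x) = 0
    rw [hL0]
    change g.val x (0 : TangentSpace I x) (0 : TangentSpace I x) = 0
    simp only [map_zero]
  · -- `Δ β(x) = ∑ₒ Hess β(fₒ, fₒ) ≤ ∑ₒ 2`
    have hβ0 : β x = 0 := by
      show g.val x (show TangentSpace I x from L x) (show TangentSpace I x from L x) = 0
      rw [hL0]
      change g.val x (0 : TangentSpace I x) (0 : TangentSpace I x) = 0
      simp only [map_zero]
    have hHess : ∀ o, g.hessian β x (f₀ o) (f₀ o) ≤ 2 * 1 := by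
      intro o
      refine hessian_le_of_le_quadratic_along_expMap g hc x (f₀ o) hsmooth (a := 0)
        fun ε hε ↦ ?_
      filter_upwards [Ioo_mem_nhds (show -εb < 0 by linarith) hεb] with σ hσb
      have hsmall : g.val x (show TangentSpace I x from σ • (f₀ o : E))
          (show TangentSpace I x from σ • (f₀ o : E)) < εb ^ 2 := by
        change g.val x (σ • f₀ o) (σ • f₀ o) < εb ^ 2
        simp only [map_smul, FunLike.coe_smul, Pi.smul_apply, smul_eq_mul, hf₀on, if_true,
          mul_one]
        nlinarith [sq_lt_sq' hσb.1 hσb.2]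
      have hLσ : L (expMap g.leviCivita x (σ • f₀ o)) = σ • (f₀ o : E) :=
        (hLF (σ • (f₀ o : E)) hsmall).2.2
      show g.val x (show TangentSpace I x from L (expMap g.leviCivita x (σ • f₀ o)))
          (show TangentSpace I x from L (expMap g.leviCivita x (σ • f₀ o))) ≤
        β x + 0 * σ + (1 + ε) * σ ^ 2
      rw [hLσ, hβ0]
      change g.val x (σ • f₀ o) (σ • f₀ o) ≤ 0 + 0 * σ + (1 + ε) * σ ^ 2
      simp only [map_smul, FunLike.coe_smul, Pi.smul_apply, smul_eq_mul, hf₀on, if_true,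
        mul_one]
      nlinarith [sq_nonneg σ, hε]
    rw [laplaceBeltrami_eq_dalembertian]
    show g.trace x (g.hessian β x) ≤ _
    rw [trace_eq_sum_of_orthonormal_frame g x hf₀on hcard]
    calc ∑ o, g.hessian β x (f₀ o) (f₀ o) ≤ ∑ o : Option (Fin k), (2 * 1 : ℝ) :=
          Finset.sum_le_sum fun o _ ↦ hHess o
      _ = 2 * (Module.finrank ℝ E : ℝ) := by
          rw [Finset.sum_const, Finset.card_univ, hcard, nsmul_eq_mul]
          ring

end Diagonal

/-! ### §4 Assembly: the barrier for manifolds modelled on `E` -/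

section Reflect

/-- Reflecting the Laplacian bound of the reversed geodesic back: with `c d = π/2`,
`∫₀ᵈ (k c² cos²(ct) − sin²(ct) f(d − t)) dt = ∫₀ᵈ (k c² sin²(cs) − cos²(cs) f(s)) ds`
(substitute `s = d − t`; `cos(π/2 − u) = sin u`). Elementary. [folklore] -/
theorem integral_reflect_cos_sin (f : ℝ → ℝ) {d c : ℝ} (k : ℝ) (hcd : c * d = Real.pi / 2) :
    (∫ t in (0 : ℝ)..d, (k * c ^ 2 * Real.cos (c * t) ^ 2 - Real.sin (c * t) ^ 2 * f (d - t))) =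
      ∫ s in (0 : ℝ)..d, (k * c ^ 2 * Real.sin (c * s) ^ 2 - Real.cos (c * s) ^ 2 * f s) := by
  set G : ℝ → ℝ := fun s ↦ k * c ^ 2 * Real.cos (c * (d - s)) ^ 2 -
    Real.sin (c * (d - s)) ^ 2 * f s with hG
  have h1 : (fun t ↦ k * c ^ 2 * Real.cos (c * t) ^ 2 - Real.sin (c * t) ^ 2 * f (d - t)) =
      fun t ↦ G (d - t) := by
    funext t
    simp only [hG, sub_sub_cancel]
  rw [h1, intervalIntegral.integral_comp_sub_left (fun s ↦ G s) d, sub_self, sub_zero]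
  refine intervalIntegral.integral_congr fun s _ ↦ ?_
  simp only [hG]
  rw [mul_sub, hcd, Real.cos_pi_div_two_sub, Real.sin_pi_div_two_sub]

end Reflect

section Assembly

variable {E : Type*} [NormedAddCommGroup E] [NormedSpace ℝ E] [FiniteDimensional ℝ E]
  [CompleteSpace E] {H : Type*} [TopologicalSpace H] {I : ModelWithCorners ℝ E H} [I.Boundaryless]
  {M : Type*} [TopologicalSpace M] [ChartedSpace H M] [IsManifold I ∞ M]
  [T2Space M] [CompactSpace M] [ConnectedSpace M]

set_option maxHeartbeats 1600000 in
/-- **Bamler 2020a, Thm. 3.5 in the barrier sense.** Let `h` be a `C^∞` family of Riemannian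
metrics on a closed connected manifold with a boundaryless model with corners on `E`, `dim E ≥ 1`,
which is a Ricci flow on the order-connected time set `S`. Then at every
`(x, y, r)` with `r ∈ S` preceded by some time of `S` and for every `η > 0` there is
`b : M → M → ℝ → ℝ` with `d_t²(x', y') ≤ b(x', y', t)` near `(x, y, r)`, `b(x, y, r) = d_r²(x, y)`,
`C²` slices `b(·, y, r)` near `x` and `b(x, ·, r)` near `y`, a time derivative `db` of `b(x, y, ·)`
at `r`, and `db − Δ_x b − Δ_y b ≥ −H − η`, `H = (dim E − 1)π²/2 + 4`
("`(∂ₜ − Δ_x − Δ_y) d_t²(x, y) ≥ −(n−1)π²/2 − 4` … in the barrier sense").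
[cite: Bamler2020Entropy, §3.1, Thm. 3.5] -/
theorem IsRicciFlow.exists_distSq_heatOperator_barrier
    {h : ℝ → PseudoRiemannianMetric I ∞ E (TangentSpace I : M → Type _)}
    (hR : ∀ r, (h r).IsRiemannian)
    {cov : ℝ → CovariantDerivative I E (TangentSpace I : M → Type _)} {S : Set ℝ}
    (hS : S.OrdConnected) (hm : 0 < Module.finrank ℝ E) (hh : IsContMDiffFamilyOn ∞ h univ)
    (hflow : IsRicciFlow h cov S) (x y : M) (r : ℝ) (hr : r ∈ S) (hs : ∃ s ∈ S, s < r)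
    (η : ℝ) (hη : 0 < η) :
    ∃ b : M → M → ℝ → ℝ,
      (∀ᶠ p in 𝓝 ((x, y, r) : M × M × ℝ),
        ((h p.2.2).edist (hR p.2.2) p.1 p.2.1).toReal ^ 2 ≤ b p.1 p.2.1 p.2.2) ∧
      b x y r = ((h r).edist (hR r) x y).toReal ^ 2 ∧
      (∀ᶠ x' in 𝓝 x, ContMDiffAt I 𝓘(ℝ, ℝ) 2 (fun x'' ↦ b x'' y r) x') ∧
      (∀ᶠ y' in 𝓝 y, ContMDiffAt I 𝓘(ℝ, ℝ) 2 (fun y'' ↦ b x y'' r) y') ∧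
      ∃ db : ℝ, HasDerivAt (fun s' ↦ b x y s') db r ∧
        -(((Module.finrank ℝ E : ℝ) - 1) * Real.pi ^ 2 / 2 + 4) - η ≤
          db - (h r).laplaceBeltrami (fun x' ↦ b x' y r) x -
            (h r).laplaceBeltrami (fun y' ↦ b x y' r) y := by
  classical
  have h2 : (2 : ℕ∞ω) ≤ (∞ : ℕ∞ω) := WithTop.coe_le_coe.2 le_top
  haveI : Fact ((1 : ℕ∞ω) ≤ (∞ : ℕ∞ω)) := ⟨by exact_mod_cast le_top⟩
  haveI : (h r).HasLeviCivita := (h r).hasLeviCivita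
  have hk1 : ((1 : ℕ∞) : ℕ∞ω) + 1 ≤ (∞ : ℕ∞ω) := by
    rw [show ((1 : ℕ∞) : ℕ∞ω) + 1 = 2 by norm_num]
    exact h2
  haveI : CovariantDerivative.ContMDiffCovariantDerivative (h r).leviCivita 1 :=
    ⟨(h r).isLocallyContMDiff_leviCivita_holds 1 hk1 univ isOpen_univ⟩
  haveI : CovariantDerivative.ContMDiffCovariantDerivative (h r).leviCivita ∞ :=
    ⟨(h r).isLocallyContMDiff_leviCivita_holds ⊤ (le_of_eq rfl) univ isOpen_univ⟩
  have hm1 : (1 : ℝ) ≤ (Module.finrank ℝ E : ℝ) := by exact_mod_cast hm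
  have hπ := Real.pi_gt_three
  -- geodesic completeness of `g_r` (closed manifold)
  have hcpl : IsGeodesicallyComplete (h r).leviCivita := by
    refine (isGeodesicallyComplete_iff_isCompact_setOf_edist_le (h r) le_rfl (hR r)).2
      fun p ρ ↦ IsClosed.isCompact ?_
    exact isClosed_le ((PseudoRiemannianMetric.continuous_edist (hR r)).comp
      (continuous_const.prodMk continuous_id)) continuous_const
  -- slice functions equal to the branches
  by_cases hxy : x = y
  · /- the diagonal: `b = d_r(x, ·)²` on both spatial slices, `0` in time -/
    subst hxy
    obtain ⟨β, hdom, hβ0, hβs, hΔ⟩ := exists_distSq_barrier_diagonal (h r) (hR r) hcpl x hm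
    have hd0 : ((h r).edist (hR r) x x).toReal ^ 2 = 0 := by
      rw [PseudoRiemannianMetric.edist_self]; simp
    refine ⟨fun x' y' t' ↦ if y' = x ∧ t' = r then β x' else if x' = x ∧ t' = r then β y'
      else if x' = x ∧ y' = x then 0 else ((h t').edist (hR t') x' y').toReal ^ 2,
      ?_, ?_, ?_, ?_, 0, ?_, ?_⟩
    · have h1 : ∀ᶠ p in 𝓝 ((x, x, r) : M × M × ℝ),
          ((h r).edist (hR r) x p.1).toReal ^ 2 ≤ β p.1 :=
        (continuous_fst.tendsto ((x, x, r) : M × M × ℝ)).eventually hdom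
      have h2' : ∀ᶠ p in 𝓝 ((x, x, r) : M × M × ℝ),
          ((h r).edist (hR r) x p.2.1).toReal ^ 2 ≤ β p.2.1 :=
        ((continuous_fst.comp continuous_snd).tendsto ((x, x, r) : M × M × ℝ)).eventually hdom
      filter_upwards [h1, h2'] with p hp1 hp2
      split_ifs with hc1 hc2 hc3
      · rw [hc1.2, hc1.1, PseudoRiemannianMetric.edist_comm]
        exact hp1
      · rw [hc2.2, hc2.1]
        exact hp2
      · rw [hc3.1, hc3.2, PseudoRiemannianMetric.edist_self]
        simp
      · exact le_rfl
    · simp only [and_self, if_true, hβ0, hd0]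
    · have hfun : (fun x'' ↦ (if x = x ∧ r = r then β x'' else if x'' = x ∧ r = r then β x
          else if x'' = x ∧ x = x then 0 else ((h r).edist (hR r) x'' x).toReal ^ 2)) = β := by
        funext x''
        simp
      rw [hfun]
      exact hβs.mono fun _ h' ↦ h'.of_le h2
    · have hfun : (fun y'' ↦ (if y'' = x ∧ r = r then β x else if x = x ∧ r = r then β y''
          else if x = x ∧ y'' = x then 0 else ((h r).edist (hR r) x y'').toReal ^ 2)) = β := by
        funext y''
        by_cases hy : y'' = x
        · simp [hy]
        · simp [hy]
      rw [hfun]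
      exact hβs.mono fun _ h' ↦ h'.of_le h2
    · have hfun : (fun s' ↦ (if x = x ∧ s' = r then β x else if x = x ∧ s' = r then β x
          else if x = x ∧ x = x then (0 : ℝ) else ((h s').edist (hR s') x x).toReal ^ 2)) =
          fun _ ↦ (0 : ℝ) := by
        funext s'
        by_cases hs' : s' = r
        · simp [hs', hβ0]
        · simp [hs']
      rw [hfun]
      exact hasDerivAt_const r 0
    · have hfun₁ : (fun x' ↦ (if x = x ∧ r = r then β x' else if x' = x ∧ r = r then β x
          else if x' = x ∧ x = x then 0 else ((h r).edist (hR r) x' x).toReal ^ 2)) = β := by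
        funext x''
        simp
      have hfun₂ : (fun y' ↦ (if y' = x ∧ r = r then β x else if x = x ∧ r = r then β y'
          else if x = x ∧ y' = x then 0 else ((h r).edist (hR r) x y').toReal ^ 2)) = β := by
        funext y''
        by_cases hy : y'' = x
        · simp [hy]
        · simp [hy]
      rw [hfun₁, hfun₂]
      have hπ2 : (0 : ℝ) ≤ Real.pi ^ 2 / 2 - 4 := by nlinarith [hπ, Real.pi_pos]
      have hprod : 0 ≤ ((Module.finrank ℝ E : ℝ) - 1) * (Real.pi ^ 2 / 2 - 4) :=
        mul_nonneg (by linarith) hπ2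
      linarith [hΔ, hprod, hη]
  · /- `x ≠ y`: a unit speed minimizing geodesic from `x` to `y` -/
    haveI : T3Space M := inferInstance
    have hd0 : (h r).edist (hR r) x y ≠ 0 := fun h0 ↦
      hxy ((PseudoRiemannianMetric.edist_eq_zero_iff (hR r)).1 h0)
    have hdtop : (h r).edist (hR r) x y ≠ ⊤ := PseudoRiemannianMetric.edist_ne_top (hR r) x y
    set dd : ℝ := ((h r).edist (hR r) x y).toReal with hdd_def
    have hdpos : 0 < dd := ENNReal.toReal_pos hd0 hdtop
    obtain ⟨v, hmin, hq⟩ :=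
      exists_isMinimizingUpTo_of_isGeodesicallyComplete (h r) le_rfl (hR r) hcpl x y
    have hy1 : y = maximalGeodesic (h r).leviCivita x v 1 := by
      rw [← hq]
      exact expMap_eq_maximalGeodesic hcpl x v
    have hdist : (h r).edist (hR r) x y = ENNReal.ofReal (Real.sqrt ((h r).val x v v)) := by
      rw [hy1, ← hmin.2, length_maximalGeodesic (hR r) hcpl x v 0 1, sub_zero, one_mul]
    have hddv : dd = Real.sqrt ((h r).val x v v) := by
      rw [hdd_def, hdist, ENNReal.toReal_ofReal (Real.sqrt_nonneg _)]
    have hvv0 : 0 ≤ (h r).val x v v := by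
      by_cases hv : v = 0
      · simp [hv]
      · exact ((hR r) x v hv).le
    have hvv : (h r).val x v v = dd ^ 2 := by rw [hddv, Real.sq_sqrt hvv0]
    set u : TangentSpace I x := dd⁻¹ • v with hu_def
    have hu : (h r).val x u u = 1 := by
      have h2' : (h r).val x u u = dd⁻¹ * dd⁻¹ * (h r).val x v v := by
        rw [hu_def]
        simp only [map_smul, FunLike.coe_smul, Pi.smul_apply, smul_eq_mul]
        ring
      rw [h2', hvv]
      field_simp
    have hyexp : expMap (h r).leviCivita x (dd • u) = y := by
      rw [hu_def, smul_smul, mul_inv_cancel₀ hdpos.ne', one_smul, ← riemannianExpMap_eq]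
      exact hq
    -- the geodesic `γ`, its reversal and unit speed
    set γ : ℝ → M := fun t ↦ expMap (h r).leviCivita x (t • u) with hγ_def
    have hgeo : IsGeodesic (h r).leviCivita γ :=
      isGeodesic_expMap_smul_of_isGeodesicallyComplete hcpl x u
    have hγfun : γ = maximalGeodesic (h r).leviCivita x u := funext fun t ↦ expMap_smul hcpl x u t
    have hγs : ContMDiff 𝓘(ℝ, ℝ) I ∞ γ := by
      rw [hγfun]
      exact (contMDiff_maximalGeodesic_family hcpl x).comp
        (contMDiff_id.prodMk (contMDiff_const (c := (show E from u))))
    have hγlift : ContMDiff 𝓘(ℝ, ℝ) I.tangent ∞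
        (fun t ↦ (TotalSpace.mk' E (γ t) (velocity I γ t) : TangentBundle I M)) :=
      contMDiff_lift_velocity_of_contMDiff hγs
    have hγ0 : γ 0 = x := by
      show expMap (h r).leviCivita x ((0 : ℝ) • u) = x
      rw [zero_smul]
      exact expMap_zero (cov := (h r).leviCivita) x
    have hγd : γ dd = y := hyexp
    have hspeed : ∀ t, (h r).val (γ t) (velocity I γ t) (velocity I γ t) = 1 := by
      intro t
      have h' := (h r).val_velocity_eq_of_isGeodesicOn_holds isOpen_univ ordConnected_univ hgeo
        (mem_univ t) (mem_univ 0)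
      have hv0 : (velocity I γ 0 : E) = (u : E) := velocity_expMap_smul_zero x u
      rw [h', hv0, hγ0, hu]
    set u₂ : TangentSpace I (γ dd) := -(velocity I γ dd) with hu₂_def
    have hu₂ : (h r).val (γ dd) u₂ u₂ = 1 := by
      rw [hu₂_def, ContinuousLinearMap.map_neg₂, map_neg, neg_neg, hspeed dd]
    have hrev := fun t ↦ expMap_smul_neg_velocity (cov := (h r).leviCivita) hcpl x u dd t
    have hxend : expMap (h r).leviCivita (γ dd) (dd • u₂) = x := by
      rw [hu₂_def]
      show expMap (h r).leviCivita (expMap (h r).leviCivita x (dd • u))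
        (dd • -(velocity I (fun s ↦ expMap (h r).leviCivita x (s • u)) dd)) = x
      rw [(hrev dd).1, sub_self, zero_smul]
      exact expMap_zero (cov := (h r).leviCivita) x
    -- Ricci along `γ` as a real function, and its reflection along the reversed geodesic
    set Rf : ℝ → ℝ := fun s ↦ (h r).leviCivita.ricci (γ s) (velocity I γ s)
      (velocity I γ s) with hRf_def
    have hRrev : ∀ t, (h r).leviCivita.ricci (expMap (h r).leviCivita (γ dd) (t • u₂))
        (velocity I (fun t' ↦ expMap (h r).leviCivita (γ dd) (t' • u₂)) t)
        (velocity I (fun t' ↦ expMap (h r).leviCivita (γ dd) (t' • u₂)) t) =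
        Rf (dd - t) := fun t ↦
      ricci_apply_eq_of_eq_of_neg (hrev t).1 _ _ (hrev t).2
    -- (1) the spatial barriers
    obtain ⟨hRic, β₂, hdom₂, hβ₂d, hβ₂s, hΔ₂⟩ :=
      exists_distSq_barrier_at_endpoint (h r) (hR r) hcpl x u hu hdpos
    obtain ⟨-, β₁, hdom₁, hβ₁d, hβ₁s, hΔ₁⟩ :=
      exists_distSq_barrier_at_endpoint (h r) (hR r) hcpl (γ dd) u₂ hu₂ hdpos
    set c : ℝ := Real.pi / (2 * dd) with hc_def
    have hcd : c * dd = Real.pi / 2 := by rw [hc_def]; field_simp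
    set kk : ℝ := (Module.finrank ℝ E : ℝ) - 1 with hkk_def
    -- rewrite the reversed bound back onto `γ`
    have hI₁ : (∫ t in (0 : ℝ)..dd, (kk * c ^ 2 * Real.cos (c * t) ^ 2 -
        Real.sin (c * t) ^ 2 * (h r).leviCivita.ricci (expMap (h r).leviCivita (γ dd) (t • u₂))
          (velocity I (fun t' ↦ expMap (h r).leviCivita (γ dd) (t' • u₂)) t)
          (velocity I (fun t' ↦ expMap (h r).leviCivita (γ dd) (t' • u₂)) t))) =
        ∫ s in (0 : ℝ)..dd, (kk * c ^ 2 * Real.sin (c * s) ^ 2 - Real.cos (c * s) ^ 2 * Rf s) := by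
      rw [← integral_reflect_cos_sin Rf kk hcd]
      exact intervalIntegral.integral_congr fun t _ ↦ by rw [hRrev t]
    rw [hxend, hI₁] at hΔ₁
    rw [hxend] at hdom₁ hβ₁d hβ₁s
    rw [hyexp] at hdom₂ hβ₂d hβ₂s hΔ₂
    rw [hγd] at hdom₁
    -- (2) the time slice
    set β₃ : ℝ → ℝ := fun t' ↦ dd * ∫ s in (0 : ℝ)..dd, (h t').val (γ s)
      (velocity I γ s) (velocity I γ s) with hβ₃_def
    have hβ₃dom : ∀ t', ((h t').edist (hR t') x y).toReal ^ 2 ≤ β₃ t' := fun t' ↦ by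
      have h' := (sq_edist_le_mul_energy_of_contMDiff (h t') (hR t') hγs hdpos.le).2
      rw [hγ0, hγd] at h'
      exact h'
    have hβ₃r : β₃ r = dd ^ 2 := by
      show dd * ∫ s in (0 : ℝ)..dd, (h r).val (γ s) (velocity I γ s)
        (velocity I γ s) = dd ^ 2
      simp_rw [hspeed]
      rw [intervalIntegral.integral_const, smul_eq_mul, mul_one, sub_zero, sq]
    have hricr : ∀ s, (cov r).ricci (γ s) (velocity I γ s) (velocity I γ s) =
        Rf s := fun s ↦ by
      rw [(hflow.isLeviCivita r hr).ricci_eq_ricci h2 (γ s)]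
      rfl
    have hβ₃' : HasDerivAt β₃ (dd * ∫ s in (0 : ℝ)..dd, -2 * Rf s) r := by
      have h' := (hflow.hasDerivAt_integral_val_along hh hS hr hs hγlift 0 dd).const_mul dd
      simp_rw [hricr] at h'
      exact h'
    -- (3) the barrier
    refine ⟨fun x' y' t' ↦ if y' = y ∧ t' = r then β₁ x' else if x' = x ∧ t' = r then β₂ y'
      else if x' = x ∧ y' = y then β₃ t' else ((h t').edist (hR t') x' y').toReal ^ 2,
      ?_, ?_, ?_, ?_, dd * ∫ s in (0 : ℝ)..dd, -2 * Rf s, ?_, ?_⟩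
    · have h1 : ∀ᶠ p in 𝓝 ((x, y, r) : M × M × ℝ),
          ((h r).edist (hR r) y p.1).toReal ^ 2 ≤ β₁ p.1 :=
        (continuous_fst.tendsto ((x, y, r) : M × M × ℝ)).eventually hdom₁
      have h2' : ∀ᶠ p in 𝓝 ((x, y, r) : M × M × ℝ),
          ((h r).edist (hR r) x p.2.1).toReal ^ 2 ≤ β₂ p.2.1 :=
        ((continuous_fst.comp continuous_snd).tendsto ((x, y, r) : M × M × ℝ)).eventually hdom₂
      filter_upwards [h1, h2'] with p hp1 hp2
      split_ifs with hc1 hc2 hc3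
      · rw [hc1.2, hc1.1, PseudoRiemannianMetric.edist_comm]
        exact hp1
      · rw [hc2.2, hc2.1]
        exact hp2
      · rw [hc3.1, hc3.2]
        exact hβ₃dom _
      · exact le_rfl
    · simp only [and_self, if_true, hβ₁d, hdd_def]
    · have hfun : (fun x'' ↦ (if y = y ∧ r = r then β₁ x'' else if x'' = x ∧ r = r then β₂ y
          else if x'' = x ∧ y = y then β₃ r else ((h r).edist (hR r) x'' y).toReal ^ 2)) = β₁ := by
        funext x''
        simp
      rw [hfun]
      exact hβ₁s.mono fun _ h' ↦ h'.of_le h2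
    · have hfun : (fun y'' ↦ (if y'' = y ∧ r = r then β₁ x else if x = x ∧ r = r then β₂ y''
          else if x = x ∧ y'' = y then β₃ r else ((h r).edist (hR r) x y'').toReal ^ 2)) = β₂ := by
        funext y''
        by_cases hy : y'' = y
        · simp [hy, hβ₁d, hβ₂d]
        · simp [hy]
      rw [hfun]
      exact hβ₂s.mono fun _ h' ↦ h'.of_le h2
    · have hfun : (fun s' ↦ (if y = y ∧ s' = r then β₁ x else if x = x ∧ s' = r then β₂ y
          else if x = x ∧ y = y then β₃ s' else ((h s').edist (hR s') x y).toReal ^ 2)) = β₃ := by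
        funext s'
        by_cases hs' : s' = r
        · simp [hs', hβ₁d, hβ₃r]
        · simp [hs']
      rw [hfun]
      exact hβ₃'
    · have hfun₁ : (fun x' ↦ (if y = y ∧ r = r then β₁ x' else if x' = x ∧ r = r then β₂ y
          else if x' = x ∧ y = y then β₃ r else ((h r).edist (hR r) x' y).toReal ^ 2)) = β₁ := by
        funext x''
        simp
      have hfun₂ : (fun y' ↦ (if y' = y ∧ r = r then β₁ x else if x = x ∧ r = r then β₂ y'
          else if x = x ∧ y' = y then β₃ r else ((h r).edist (hR r) x y').toReal ^ 2)) = β₂ := by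
        funext y''
        by_cases hy : y'' = y
        · simp [hy, hβ₁d, hβ₂d]
        · simp [hy]
      rw [hfun₁, hfun₂]
      -- the three integrals sum to `(n − 1) c² dd`
      have hRc : ContinuousOn Rf (uIcc 0 dd) := by rw [uIcc_of_le hdpos.le]; exact hRic
      have hAi : IntervalIntegrable (fun s ↦ kk * c ^ 2 * Real.sin (c * s) ^ 2 -
          Real.cos (c * s) ^ 2 * Rf s) volume 0 dd :=
        (((Continuous.continuousOn (by fun_prop)).sub
          ((Continuous.continuousOn (by fun_prop)).mul hRc))).intervalIntegrable
      have hBi : IntervalIntegrable (fun s ↦ kk * c ^ 2 * Real.cos (c * s) ^ 2 -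
          Real.sin (c * s) ^ 2 * Rf s) volume 0 dd :=
        (((Continuous.continuousOn (by fun_prop)).sub
          ((Continuous.continuousOn (by fun_prop)).mul hRc))).intervalIntegrable
      have hRi : IntervalIntegrable Rf volume 0 dd := hRc.intervalIntegrable
      have hR2 : (∫ s in (0 : ℝ)..dd, -2 * Rf s) = -2 * ∫ s in (0 : ℝ)..dd, Rf s :=
        intervalIntegral.integral_const_mul _ _
      have hsum : (∫ s in (0 : ℝ)..dd, (kk * c ^ 2 * Real.sin (c * s) ^ 2 -
            Real.cos (c * s) ^ 2 * Rf s)) +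
          (∫ s in (0 : ℝ)..dd, (kk * c ^ 2 * Real.cos (c * s) ^ 2 -
            Real.sin (c * s) ^ 2 * Rf s)) + (∫ s in (0 : ℝ)..dd, Rf s) = kk * c ^ 2 * dd := by
        rw [← intervalIntegral.integral_add hAi hBi,
          ← intervalIntegral.integral_add (hAi.add hBi) hRi,
          intervalIntegral.integral_congr (g := fun _ ↦ kk * c ^ 2) fun s _ ↦ by
            linear_combination (kk * c ^ 2 - Rf s) * Real.sin_sq_add_cos_sq (c * s),
          intervalIntegral.integral_const, smul_eq_mul, sub_zero]
        ring
      have hsum' : 2 * dd * ((∫ s in (0 : ℝ)..dd, (kk * c ^ 2 * Real.sin (c * s) ^ 2 -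
            Real.cos (c * s) ^ 2 * Rf s)) +
          (∫ s in (0 : ℝ)..dd, (kk * c ^ 2 * Real.cos (c * s) ^ 2 -
            Real.sin (c * s) ^ 2 * Rf s)) + (∫ s in (0 : ℝ)..dd, Rf s)) =
          2 * dd * (kk * c ^ 2 * dd) := by rw [hsum]
      have hc2 : 2 * dd * (kk * c ^ 2 * dd) = kk * Real.pi ^ 2 / 2 := by
        rw [hc_def]
        field_simp
      rw [hR2]
      nlinarith [hΔ₁, hΔ₂, hsum', hc2, hη, hdpos]

end Assembly

/-! ### §5 The named fact: the self model `𝓘(ℝ, ℝᵐ)`, and the discharge -/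

section Euclidean

universe u v

/-- **Bamler 2020a, Thm. 3.5 (barrier sense) for closed manifolds charted on `ℝᵐ` itself**
(`I = 𝓘(ℝ, EuclideanSpace ℝ (Fin m)) = 𝓡 m`): the statement of the named fact
`bamler_distSq_heatOperator_barrier` with `H = EuclideanSpace ℝ (Fin m)` and the self model,
`H_m = MetricFlow.concentrationConst m = (m − 1)π²/2 + 4`
(`IsRicciFlow.exists_distSq_heatOperator_barrier` with `dim ℝᵐ = m`). This is the form consumed
through the hypothesis `hbar` of `isHConcentrated_ricciFlowMetricFlow_of_barrier` for flows on
`𝓡 m`-manifolds. [cite: Bamler2020Entropy, §3.1, Thm. 3.5] -/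
theorem bamler_distSq_heatOperator_barrier_euclidean {m : ℕ} {M : Type v} [TopologicalSpace M]
    [ChartedSpace (EuclideanSpace ℝ (Fin m)) M]
    [IsManifold 𝓘(ℝ, EuclideanSpace ℝ (Fin m)) ∞ M] [T2Space M] [CompactSpace M]
    [ConnectedSpace M]
    (h : ℝ → PseudoRiemannianMetric 𝓘(ℝ, EuclideanSpace ℝ (Fin m)) ∞ (EuclideanSpace ℝ (Fin m))
      (TangentSpace 𝓘(ℝ, EuclideanSpace ℝ (Fin m)) : M → Type _))
    (hR : ∀ r, (h r).IsRiemannian)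
    {cov : ℝ → CovariantDerivative 𝓘(ℝ, EuclideanSpace ℝ (Fin m)) (EuclideanSpace ℝ (Fin m))
      (TangentSpace 𝓘(ℝ, EuclideanSpace ℝ (Fin m)) : M → Type _)}
    {S : Set ℝ} (hS : S.OrdConnected) (hm : 0 < m) (hh : IsContMDiffFamilyOn ∞ h univ)
    (hflow : IsRicciFlow h cov S) (x y : M) (r : ℝ) (hr : r ∈ S) (hs : ∃ s ∈ S, s < r)
    (η : ℝ) (hη : 0 < η) :
    ∃ b : M → M → ℝ → ℝ,
      (∀ᶠ p in 𝓝 ((x, y, r) : M × M × ℝ),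
        ((h p.2.2).edist (hR p.2.2) p.1 p.2.1).toReal ^ 2 ≤ b p.1 p.2.1 p.2.2) ∧
      b x y r = ((h r).edist (hR r) x y).toReal ^ 2 ∧
      (∀ᶠ x' in 𝓝 x, ContMDiffAt 𝓘(ℝ, EuclideanSpace ℝ (Fin m)) 𝓘(ℝ, ℝ) 2
        (fun x'' ↦ b x'' y r) x') ∧
      (∀ᶠ y' in 𝓝 y, ContMDiffAt 𝓘(ℝ, EuclideanSpace ℝ (Fin m)) 𝓘(ℝ, ℝ) 2
        (fun y'' ↦ b x y'' r) y') ∧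
      ∃ db : ℝ, HasDerivAt (fun s' ↦ b x y s') db r ∧
        -MetricFlow.concentrationConst m - η ≤ db - (h r).laplaceBeltrami (fun x' ↦ b x' y r) x -
          (h r).laplaceBeltrami (fun y' ↦ b x y' r) y := by
  have hfin : Module.finrank ℝ (EuclideanSpace ℝ (Fin m)) = m := finrank_euclideanSpace_fin
  have hm' : 0 < Module.finrank ℝ (EuclideanSpace ℝ (Fin m)) := by rw [hfin]; exact hm
  obtain ⟨b, h1, h2, h3, h4, db, h5, h6⟩ :=
    hflow.exists_distSq_heatOperator_barrier hR hS hm' hh x y r hr hs η hη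
  refine ⟨b, h1, h2, h3, h4, db, h5, ?_⟩
  have hc : MetricFlow.concentrationConst m =
      ((Module.finrank ℝ (EuclideanSpace ℝ (Fin m)) : ℝ) - 1) * Real.pi ^ 2 / 2 + 4 := by
    rw [hfin]
    rfl
  rw [hc]
  exact h6

/-- **Discharge of the named fact `bamler_distSq_heatOperator_barrier`** (Bamler 2020a, §3.1,
Thm. 3.5, barrier form): closed manifolds with an arbitrary boundaryless model with corners on
`ℝᵐ`, `m ≥ 1` (`IsRicciFlow.exists_distSq_heatOperator_barrier` with `dim ℝᵐ = m`).
[cite: Bamler2020Entropy, §3.1, Thm. 3.5] -/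
theorem bamler_distSq_heatOperator_barrier_holds : bamler_distSq_heatOperator_barrier := by
  intro m H _ I _ M _ _ _ _ _ _ h hR cov S hS hm hh hflow x y r hr hs η hη
  have hfin : Module.finrank ℝ (EuclideanSpace ℝ (Fin m)) = m := finrank_euclideanSpace_fin
  have hm' : 0 < Module.finrank ℝ (EuclideanSpace ℝ (Fin m)) := by rw [hfin]; exact hm
  obtain ⟨b, h1, h2, h3, h4, db, h5, h6⟩ :=
    hflow.exists_distSq_heatOperator_barrier hR hS hm' hh x y r hr hs η hη
  refine ⟨b, h1, h2, h3, h4, db, h5, ?_⟩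
  have hc : MetricFlow.concentrationConst m =
      ((Module.finrank ℝ (EuclideanSpace ℝ (Fin m)) : ℝ) - 1) * Real.pi ^ 2 / 2 + 4 := by
    rw [hfin]
    rfl
  rw [hc]
  exact h6

end Euclidean

end Literature.Geometry.Riemannian
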